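import Summits.ResolutionOfSingularities.ResolutionOfSingularities.Theorems.FrobeniusClosingPatchingRelPerfectDepthTargetsR5HIntegral
import Summits.ResolutionOfSingularities.ResolutionOfSingularities.Theorems.FrobeniusClosingPatchingRelPerfectDepthHSepOffCentre
import Summits.ResolutionOfSingularities.ResolutionOfSingularities.Theorems.FrobeniusClosingPatchingRelPerfectDepthOneDictionaryStepCentre
import Summits.ResolutionOfSingularities.ResolutionOfSingularities.Theorems.FrobeniusClosingPatchingRelPerfectDepthMixedFormatBTraces
import Literature.AlgebraicGeometry.Resolution.ControlledTransformBaseChange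
import HarnessLib

/-!
# `PatchingRelPerfect` (stmt-ResolutionOfSingularities-16161), chain W5.2 — rung R5ᴴ, N2: THE WEIGHT-ONE H-LED STEP
# (`hLedStepI : HLedStepI`)

[OURS · L1 W5.2 · res-D-pv-055, owner of R5ᴴ (res-L1-w52-plan-1 RULING G10-2/G10-3)] The X-side step of the rung: a move of the
separation game on the (integral, regular) carrier `W` of an `HLedStateI` — the blowing up `τ : W' → W` of a connected regular
centre `V(C)` lying on a charged boundary member — is realised by the blowing up `σ : X' → X` of `X` along `Ĉ = C.map i`; the state
is re-established on the strict transform `W'` with the boundary `ℬ' = [(σᶜ(B,1), a)]_{(B,a) ∈ ℬ} ++ [(Ĉ𝒪, w − 1)]`, and the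
restriction of `ℬ'` to `W'` IS the E-side law of `HSepSeq` (T-R5H p535426 / T-R5Hb p537938).

Proof = the weight-ONE instance of pv-009's dictionary step (`DepthOne.dictionaryStep_mixed`, pattern followed line by line) with
two additions: (i) the centre is over the closed point because it lies on a charged member (not because the carrier is), and (ii) the
boundary bookkeeping `σ^*(Π B^a) = (Ĉ𝒪)^w · Π σᶜ(B,1)^a`, member by member: `σ^*B = Ĉ𝒪 · σᶜ(B,1)` for the members THROUGH the
centre (`IsBlowup.comap_mul_controlledTransform_one`), `σᶜ(B,1) = σ^*B` for the others (the off-centre tool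
`controlledTransform_one_eq_comap_of_not_le`, p538746, on `X` and on `W`), `w` = the total exponent through the centre read on
`W` (`DepthGraded.Trace.weightOf_divisorsOver_map_eq`).

* `HLedStep.comap_monomialIdeal_eq_pow_mul` — the bookkeeping identity (ii);
* **`hLedStepI : HLedStepI`** — the target, hence (T-R5Hb) `hLedTowerI_of_step hLedStepI : HLedTowerI`.

Honest framing: OURS (AI-written, weaker than expert review); nothing here is a statement of the manuscript under review.

## Sources
* J. Kollár, *Lectures on Resolution of Singularities* (2007), (3.111) Step 3, 3.30.2. [Kollar2007]
* E. Bierstone, D. Grigoriev, P. Milman, J. Włodarczyk (2011), §3.2 Lemma 3.2.1 (controlled transform). [BierstoneGrigorievMilmanWlodarczyk2011]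
* U. Görtz, T. Wedhorn, *Algebraic Geometry I* (2020), (13.19), Prop. 13.91 (1), 13.96 (2) (strict transforms). [GortzWedhorn2020]
* The Stacks Project, Tag 080A. [StacksProject]
-/

set_option linter.dupNamespace false -- mandated namespace of this single-conjunct summit

noncomputable section

open CategoryTheory CategoryTheory.Limits AlgebraicGeometry TopologicalSpace IsLocalRing
open Literature.AlgebraicGeometry.Resolution Scheme.IdealSheafData

namespace Summit.ResolutionOfSingularities.ResolutionOfSingularities.Theorems.DepthTargets

universe u

namespace HLedStep

variable {W X X' : Scheme.{u}} (i : W ⟶ X) [IsClosedImmersion i] {σ : X' ⟶ X} {C : W.IdealSheafData}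

/-! ## §1 The boundary bookkeeping `σ^*(Π B^a) = (Ĉ𝒪)^w · Π σᶜ(B,1)^a` -/

/-- **Pull-back of the boundary monomial**: for a list `L` of effective Cartier members and a finset `T` deciding «contains the
centre» on `L` (`B ∈ T ↔ B ≤ Ĉ` for the members of `L`), with `σ^*B = Ĉ𝒪 · σᶜ(B,1)` on `T` and `σᶜ(B,1) = σ^*B` off `T`:
`σ^*(monomialIdeal L) = (Ĉ𝒪)^{weightOf L T} · monomialIdeal (L.map (σᶜ(·,1)))`. [cite: Kollar2007, (3.111) Step 3] -/
theorem comap_monomialIdeal_eq_pow_mul (Ch : X.IdealSheafData) (T : Finset X.IdealSheafData)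
    (L : List (X.IdealSheafData × ℕ))
    (hin : ∀ p ∈ L, p.1 ∈ T → Ch.comap σ * controlledTransform σ Ch p.1 1 = p.1.comap σ)
    (hout : ∀ p ∈ L, p.1 ∉ T → controlledTransform σ Ch p.1 1 = p.1.comap σ) :
    (monomialIdeal L).comap σ =
      Ch.comap σ ^ weightOf L T * monomialIdeal (L.map fun p => (controlledTransform σ Ch p.1 1, p.2)) := by
  classical
  induction L with
  | nil => rw [monomialIdeal_nil, comap_top, weightOf_nil, pow_zero, List.map_nil, monomialIdeal_nil, one_mul]
  | cons q L ih =>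
    have ih' := ih (fun p hp => hin p (List.mem_cons_of_mem _ hp)) (fun p hp => hout p (List.mem_cons_of_mem _ hp))
    rw [monomialIdeal_cons, comap_mul, comap_pow, ih', List.map_cons, monomialIdeal_cons, weightOf_cons]
    by_cases hq : q.1 ∈ T
    · rw [if_pos hq, ← hin q List.mem_cons_self hq, pow_add, mul_pow]
      ring
    · rw [if_neg hq, zero_add, ← hout q List.mem_cons_self hq]
      ring

/-! ## §2 The step -/

end HLedStep

open HLedStep in
/-- [OURS · L1 W5.2 · R5ᴴ] **N2 — THE WEIGHT-ONE H-LED STEP: `HLedStepI` holds.** [cite: Kollar2007, (3.111) Step 3, 3.30.2]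
[cite: BierstoneGrigorievMilmanWlodarczyk2011, §3.2 Lemma 3.2.1] [cite: GortzWedhorn2020, Prop. 13.91 (1), Prop. 13.96 (2)] -/
theorem hLedStepI : HLedStepI.{u} := by
  intro S _ _ I W X i g ℬ hst W' τ C hC hconn hw hτ
  classical
  haveI := hst.isNoetherian
  haveI := hst.isClosedImmersion
  haveI := hst.isIntegral_host
  have hX : Scheme.IsRegular X := hst.isRegular
  have hWreg : Scheme.IsRegular W := hst.isRegular_host
  haveI : IsLocallyNoetherian W := LocallyOfFiniteType.isLocallyNoetherian i
  haveI : CompactSpace W := i.isClosedEmbedding.compactSpace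
  haveI : IsNoetherian W := {}
  -- the centre pushed into `X`
  set Ch : X.IdealSheafData := C.map i with hCh
  have hkerCh : i.ker ≤ Ch := DepthOne.ker_le_map_centre i C
  have hChW : Ch.comap i = C := DepthOne.comap_map_centre i C
  have hChreg : Scheme.IsRegular Ch.subscheme := DepthOne.isRegular_subscheme_map i C hC
  have hChsuppW : ((Ch.support : Set X)) = i.base '' (C.support : Set W) := DepthOne.support_map_eq_image i C
  have hChconn : _root_.IsPreconnected (Ch.support : Set X) := by
    rw [hChsuppW]; exact hconn.image _ i.continuous.continuousOn
  have hChker : (Ch.support : Set X) ⊆ i.ker.support :=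
    (DepthOne.support_map_subset_range i C).trans (Scheme.Hom.range_subset_ker_support i)
  -- a charged member through the centre: `B₁ ≤ Ĉ`, `1 ≤ a₁`
  obtain ⟨p₁, hp₁, -, hp₁C⟩ := exists_mem_le_centre_of_one_le_weightOf hw
  obtain ⟨q₁, hq₁, hq₁p⟩ : ∃ q ∈ ℬ, (q.1.comap i, q.2) = p₁ := by
    unfold restrictBoundary at hp₁; exact List.mem_map.mp hp₁
  have hB₁W : q₁.1.comap i ≤ C := by rw [← hq₁p] at hp₁C; exact hp₁C
  have hB₁Ch : q₁.1 ≤ Ch := Scheme.IdealSheafData.le_map_iff_comap_le.mpr hB₁W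
  have hB₁Wcart : IsEffectiveCartier (q₁.1.comap i) := hst.restrict_cartier q₁ hq₁
  have hChpt : ∀ x : X, x ∈ (Ch.support : Set X) → g.base x = IsLocalRing.closedPoint S :=
    fun x hx => hst.boundary_support q₁ hq₁ x (support_antitone hB₁Ch hx)
  have hChsupp : (Ch.support : Set X) ⊆ g.base ⁻¹' {IsLocalRing.closedPoint S} :=
    fun x hx => Set.mem_preimage.mpr (Set.mem_singleton_iff.mpr (hChpt x hx))
  have hCsuppB₁ : (C.support : Set W) ⊆ (q₁.1.comap i).support := support_antitone hB₁W
  -- `C ≠ ⊥`: the centre is nowhere dense in the integral `W` (it lies on the Cartier divisor `B₁|_W`)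
  have hCne : C ≠ ⊥ := by
    intro h0
    rw [h0, le_bot_iff] at hB₁W
    -- an effective Cartier divisor on the non-empty `W` is not `⊥` (tree `DatumToEmbedded.Lift.ne_bot_of_isEffectiveCartier`,
    -- inlined to keep the imports light)
    obtain ⟨U, hxU, f, hf, hU⟩ := hB₁Wcart (Classical.arbitrary W)
    rw [hB₁W, Scheme.IdealSheafData.ideal_bot, Pi.bot_apply, eq_comm, Ideal.span_singleton_eq_bot] at hU
    subst hU
    haveI : Nonempty (U : W.Opens) := ⟨⟨_, hxU⟩⟩
    exact zero_notMem_nonZeroDivisors hf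
  -- «member through the centre» read on `W` and on `X`
  have hmemW : ∀ q ∈ ℬ, q.1 ≤ Ch ↔ q.1.comap i ≤ C := fun q _ => Scheme.IdealSheafData.le_map_iff_comap_le
  -- blow `X` up along `Ĉ`; the strict-transform morphism
  obtain ⟨X', σ, hσ⟩ := exists_isBlowup X Ch
  have hτ' : IsBlowup τ (Ch.comap i) := by rw [hChW]; exact hτ
  set i' : W' ⟶ X' := hσ.strictTransformHom hτ' with hi'def
  have hsq : i' ≫ σ = τ ≫ i := hσ.strictTransformHom_comp hτ'
  haveI hi' : IsClosedImmersion i' := hσ.isClosedImmersion_of_comp_eq hτ' hsq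
  haveI : IsProper σ := hσ.isProper
  haveI : IsLocallyNoetherian X' := LocallyOfFiniteType.isLocallyNoetherian σ
  haveI : CompactSpace X' := QuasiCompact.compactSpace_of_compactSpace σ
  have hX'N : IsNoetherian X' := {}
  have hX'reg : Scheme.IsRegular X' := hσ.isRegular_of_isRegular_subscheme hX hChreg
  have hW'reg : Scheme.IsRegular W' := hτ.isRegular_of_isRegular_subscheme hWreg hC
  haveI : IsLocallyNoetherian W' := hτ.isLocallyNoetherian
  have hW'int : IsIntegral W' := hτ.isIntegral hCne
  -- the ideal of the strict transform
  have hker : i'.ker = controlledTransform σ Ch i.ker 1 :=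
    hσ.ker_strictTransformHom_of_isRegular hX hChreg hτ' hkerCh (DepthOne.isRegular_subscheme_ker i hWreg)
  have hexc : IsEffectiveCartier (Ch.comap σ) := hσ.isEffectiveCartier
  have hkerfac : Ch.comap σ * i'.ker = i.ker.comap σ := by
    rw [hker]; exact hσ.comap_mul_controlledTransform_one hkerCh
  have hkerE' : IsEffectiveCartier i'.ker := by
    have h2 : IsEffectiveCartier (i.ker.comap σ) := hst.isEffectiveCartier_ker.comap_of_isBlowup hσ
    rw [← hkerfac] at h2
    exact h2.of_mul_right
  -- the exceptional divisor restricted to `W'`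
  have hexcW : (Ch.comap σ).comap i' = C.comap τ := by
    rw [← Scheme.IdealSheafData.comap_comp, hsq, Scheme.IdealSheafData.comap_comp, hChW]
  have hexcWcart : IsEffectiveCartier ((Ch.comap σ).comap i') := by rw [hexcW]; exact hτ.isEffectiveCartier
  -- the two laws, member by member, on `X` and restricted to `W'`
  have hin : ∀ q ∈ ℬ, q.1 ≤ Ch → Ch.comap σ * controlledTransform σ Ch q.1 1 = q.1.comap σ :=
    fun q _ hle => hσ.comap_mul_controlledTransform_one hle
  have hout : ∀ q ∈ ℬ, ¬ q.1 ≤ Ch → controlledTransform σ Ch q.1 1 = q.1.comap σ :=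
    fun q hq hnle => controlledTransform_one_eq_comap_of_not_le hX hChreg hChconn hst.isEffectiveCartier_ker hChker
      (hst.boundary_cartier q hq) hnle hσ
  have hres : ∀ q ∈ ℬ, (controlledTransform σ Ch q.1 1).comap i' = controlledTransform τ C (q.1.comap i) 1 := by
    intro q hq
    by_cases hle : q.1 ≤ Ch
    · have hle' : q.1.comap σ ≤ Ch.comap σ ^ 1 := by
        rw [pow_one]; exact Scheme.IdealSheafData.comap_mono (f := σ) hle
      have h := comap_controlledTransform_of_isEffectiveCartier i hsq Ch q.1 1 hexc hle' hexcWcart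
      rwa [hChW] at h
    · have hnleW : ¬ q.1.comap i ≤ C := fun h => hle ((hmemW q hq).mpr h)
      rw [hout q hq hle, ← Scheme.IdealSheafData.comap_comp, hsq, Scheme.IdealSheafData.comap_comp]
      exact (controlledTransform_one_eq_comap_of_not_le hWreg hC hconn hB₁Wcart hCsuppB₁ (hst.restrict_cartier q hq)
        hnleW hτ).symm
  -- the weights on `X` and on `W` agree
  set w : ℕ := weightOf (restrictBoundary i ℬ) (divisorsOver (restrictBoundary i ℬ) C C.support) with hw_def
  have hwX : weightOf ℬ (divisorsOver ℬ Ch Ch.support) = w := DepthGraded.Trace.weightOf_divisorsOver_map_eq i rfl C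
  have hw1 : 1 ≤ w := hw
  -- the new boundary
  set ℬ' : List (X'.IdealSheafData × ℕ) :=
    ℬ.map (fun p => (controlledTransform σ Ch p.1 1, p.2)) ++ [(Ch.comap σ, w - 1)] with hℬ'
  -- the bookkeeping identity
  have hmono : (monomialIdeal ℬ).comap σ =
      Ch.comap σ ^ w * monomialIdeal (ℬ.map fun p => (controlledTransform σ Ch p.1 1, p.2)) := by
    rw [← hwX]
    refine comap_monomialIdeal_eq_pow_mul Ch (divisorsOver ℬ Ch Ch.support) ℬ (fun q hq hqT => hin q hq ?_)
      (fun q hq hqT => hout q hq ?_)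
    · exact le_centre_iff_forall_stalkIdeal_le.mpr (mem_divisorsOver_iff.mp hqT).2
    · intro hle
      exact hqT (mem_divisorsOver_iff.mpr ⟨fst_mem_boundaryOf hq, le_centre_iff_forall_stalkIdeal_le.mp hle⟩)
  refine ⟨X', σ, i', ℬ', hsq, hσ, ?_, ?_⟩
  · -- the new state
    obtain ⟨K₀, hgK, hKsupp⟩ := hst.exists_isBlowup_supported
    obtain ⟨M, hM, hIMK⟩ := hst.exists_format
    exact {
      isNoetherian := hX'N
      isRegular := hX'reg
      isRegular_host := hW'reg
      isClosedImmersion := hi'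
      isEffectiveCartier_ker := hkerE'
      exists_isBlowup_supported := by
        obtain ⟨Q, hQ, hQsupp⟩ := hgK.exists_isBlowup_comp_supported g K₀ σ Ch
          {IsLocalRing.closedPoint S} hKsupp hσ hChsupp
        exact ⟨Q, hQ, hQsupp⟩
      boundary_cartier := by
        intro p hp
        rw [hℬ', List.mem_append, List.mem_map, List.mem_singleton] at hp
        rcases hp with ⟨q, hq, rfl⟩ | rfl
        · by_cases hle : q.1 ≤ Ch
          · exact hσ.isEffectiveCartier_controlledTransform_of_le_pow (hst.boundary_cartier q hq) (by rwa [pow_one])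
          · rw [hout q hq hle]; exact (hst.boundary_cartier q hq).comap_of_isBlowup hσ
        · exact hexc
      boundary_support := by
        intro p hp x hx
        rw [hℬ', List.mem_append, List.mem_map, List.mem_singleton] at hp
        rcases hp with ⟨q, hq, rfl⟩ | rfl
        · have hx' : x ∈ ((q.1.comap σ).support : Set X') :=
            support_antitone (comap_le_controlledTransform σ Ch q.1 1) hx
          rw [support_comap, Closeds.coe_preimage, Set.mem_preimage] at hx'
          exact hst.boundary_support q hq (σ.base x) hx'
        · have hx' : σ.base x ∈ (Ch.support : Set X) := by
            rw [support_comap, Closeds.coe_preimage, Set.mem_preimage] at hx; exact hx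
          exact hChpt _ hx'
      exists_format := by
        refine ⟨M.comap σ * Ch.comap σ, (hM.comap_of_isBlowup hσ).mul hexc, ?_⟩
        rw [Scheme.IdealSheafData.comap_comp, hIMK, comap_mul, comap_sup, ← hkerfac, hmono, hℬ', monomialIdeal_append,
          monomialIdeal_singleton]
        -- `σ^*M · (Ĉ𝒪·𝓘_{W'} ⊔ Ĉ𝒪^w · mono') = (σ^*M · Ĉ𝒪) · (𝓘_{W'} ⊔ mono' · Ĉ𝒪^{w-1})`
        obtain ⟨w', hw'⟩ : ∃ w', w = w' + 1 := ⟨w - 1, by omega⟩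
        rw [hw', Nat.add_sub_cancel, pow_succ, ← add_eq_sup, ← add_eq_sup]
        ring
      isIntegral_host := hW'int
      restrict_cartier := by
        intro p hp
        rw [hℬ', List.mem_append, List.mem_map, List.mem_singleton] at hp
        rcases hp with ⟨q, hq, rfl⟩ | rfl
        · dsimp only
          rw [hres q hq]
          by_cases hle : q.1.comap i ≤ C
          · exact hτ.isEffectiveCartier_controlledTransform_of_le_pow (hst.restrict_cartier q hq) (by rwa [pow_one])
          · rw [controlledTransform_one_eq_comap_of_not_le hWreg hC hconn hB₁Wcart hCsuppB₁ (hst.restrict_cartier q hq)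
              hle hτ]
            exact (hst.restrict_cartier q hq).comap_of_isBlowup hτ
        · dsimp only
          rw [hexcW]; exact hτ.isEffectiveCartier }
  · -- the restriction of the new boundary IS the E-side law
    simp only [hℬ', restrictBoundary, List.map_append, List.map_map, List.map_cons, List.map_nil]
    rw [hexcW]
    congr 1
    refine List.map_congr_left fun q hq => ?_
    simp only [Function.comp_apply, hres q hq]

end Summit.ResolutionOfSingularities.ResolutionOfSingularities.Theorems.DepthTargets

end
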